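import Summits.Ventures.Crystal3D.Theorems.StickyWulffConstantGenericWallFloorStackWalkInjectiveTiltRef
import HarnessLib

/-!
# The stack walk with a vertical TILTED from an arbitrary reference vertical `e`: `e`-monotonicity, bounded drift,
# and injectivity of `top ↦ end state` over an `e`-window — WIDE tilt `‖z − e‖ ≤ 1/3` (crux `GenericWallFloor`, stmt-Ventures-19480, `WallLedgerG`)

HONEST FRAMING. Part of the venture `Summits/Ventures/Crystal3D` (cell `crystal3d-full`), helper `--supports` the
crux `GenericWallFloor` of `route-Ventures-StickyWulffConstant`, REGISTERED line `WallLedgerG`, open stub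
`stub_twoSlabAdhesion` (general fillings).  Rung credit only; F-C1 not moved; NOT the stub.

`…StackWalkInjectiveTiltRef` (19480-p1 g7) is the tilt toolkit for `‖z − e‖ ≤ 1/4`.  The cone bound tolerates any
tilt `< 3/8`; this file restates the toolkit for the WIDE tilt `‖z − e‖ ≤ 1/3` (steps still rise `≥ 1/24` in `e`, z-steep
slots `≥ 11/30`, drift `‖Δ‖ ≤ 24⟪Δ, e⟫`), so that slots of `e`-component `≥ 9/20` become walkable (in-plane slots of planes
tilted by `θ` with `(√3/2) sin θ ≥ 9/20`, i.e. `sin θ ≥ 0.52`): `…_wide` versions of every lemma, same proofs.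
WHAT THIS IS NOT: not the stub; no ledger here (next file `…StackLedgerOneSidedDownTilt`); F-C1 not moved.
-/

noncomputable section

namespace Summit.Ventures.Crystal3D.Theorems

open Finset
open Literature.MathematicalPhysics.StatisticalMechanics (fccStacking)
open scoped InnerProductSpace

variable {X : Finset (EuclideanSpace ℝ (Fin 3))}

/-! ### Tilt arithmetic relative to a reference vertical `e` -/

/-- **Tilt transfer.**  If `‖z − e‖ ≤ 1/4` then `⟪d, e⟫ ≥ ⟪d, z⟫ − ‖d‖/4`. -/
theorem inner_ref_ge_of_tilt_wide {z e : EuclideanSpace ℝ (Fin 3)} (hze : ‖z - e‖ ≤ 1 / 3) (d : EuclideanSpace ℝ (Fin 3)) :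
    ⟪d, z⟫_ℝ - ‖d‖ / 3 ≤ ⟪d, e⟫_ℝ := by
  have h1 : ⟪d, z⟫_ℝ - ⟪d, e⟫_ℝ = ⟪d, z - e⟫_ℝ := by rw [inner_sub_right]
  have h2 : ⟪d, z - e⟫_ℝ ≤ ‖d‖ * ‖z - e‖ := real_inner_le_norm _ _
  have h3 : ‖d‖ * ‖z - e‖ ≤ ‖d‖ * (1 / 3) := mul_le_mul_of_nonneg_left hze (norm_nonneg _)
  linarith

/-- A unit step rising by `≥ 3/8` in the tilted vertical rises by `≥ 1/8` in the reference vertical. -/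
theorem step_ref_rise_of_tilt_wide {z e d : EuclideanSpace ℝ (Fin 3)} (hze : ‖z - e‖ ≤ 1 / 3) (hd : ‖d‖ = 1)
    (hrise : (3 / 8 : ℝ) ≤ ⟪d, z⟫_ℝ) : (1 / 24 : ℝ) ≤ ⟪d, e⟫_ℝ := by
  have := inner_ref_ge_of_tilt_wide hze d
  rw [hd] at this
  linarith

/-- A slot that is steep for the tilted vertical rises by `≥ 9/20` in the reference vertical. -/
theorem slot_ref_rise_of_tilt_wide {z e : EuclideanSpace ℝ (Fin 3)} (hze : ‖z - e‖ ≤ 1 / 3)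
    (A : EuclideanSpace ℝ (Fin 3) ≃ₗᵢ[ℝ] EuclideanSpace ℝ (Fin 3)) {u : EuclideanSpace ℝ (Fin 3)} (hu : u ∈ fccSlots)
    (hsteep : Real.sqrt 2 / 2 ≤ ⟪A u, z⟫_ℝ) : (11 / 30 : ℝ) ≤ ⟪A u, e⟫_ℝ := by
  have h := inner_ref_ge_of_tilt_wide hze (A u)
  rw [LinearIsometryEquiv.norm_map, norm_eq_one_of_mem_fccSlots hu] at h
  have hs2 : (7 / 10 : ℝ) ≤ Real.sqrt 2 / 2 := by
    rw [le_div_iff₀ (by norm_num : (0:ℝ) < 2)]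
    have : (7 / 10 * 2 : ℝ) = Real.sqrt ((7 / 5) ^ 2) := by rw [Real.sqrt_sq (by norm_num)]; norm_num
    rw [this]; exact Real.sqrt_le_sqrt (by norm_num)
  linarith

/-- **Cone ⇒ drift.**  If `‖Δ‖ ≤ (8/3)⟪Δ, z⟫` and `‖z − e‖ ≤ 1/4` then `0 ≤ ⟪Δ, e⟫` and `‖Δ‖ ≤ 8⟪Δ, e⟫`. -/
theorem disp_le_of_cone_of_tilt_ref_wide {z e Δ : EuclideanSpace ℝ (Fin 3)} (hze : ‖z - e‖ ≤ 1 / 3)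
    (hcone : ‖Δ‖ ≤ 8 / 3 * ⟪Δ, z⟫_ℝ) : 0 ≤ ⟪Δ, e⟫_ℝ ∧ ‖Δ‖ ≤ 24 * ⟪Δ, e⟫_ℝ := by
  have h := inner_ref_ge_of_tilt_wide hze Δ
  have hn := norm_nonneg Δ
  constructor
  · nlinarith
  · nlinarith

/-! ### Monotonicity and drift along a run -/

/-- **Displacement control along a run with a tilted vertical**: `0 ≤ ⟪Δ, e⟫` and `‖Δ‖ ≤ 8⟪Δ, e⟫` for the
displacement `Δ` after any number of steps from a state satisfying `WalkInv`. -/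
theorem walkRun_disp_le_of_tilt_ref_wide (hX : ∀ p ∈ X, ∀ q ∈ X, p ≠ q → 1 ≤ dist p q)
    {s₀ : EuclideanSpace ℝ (Fin 3)} (hs₀ : s₀ ∈ fccSlots)
    (hcert : ExactOnly 0 (fccSlots.filter fun w => 0 < ⟪w, s₀⟫_ℝ))
    {z e : EuclideanSpace ℝ (Fin 3)} (hz : ‖z‖ = 1) (hze : ‖z - e‖ ≤ 1 / 3)
    {s : EuclideanSpace ℝ (Fin 3) × List WalkEntry} (hI : WalkInv X z s) (k : ℕ) :
    0 ≤ ⟪(walkRun X z k s).1 - s.1, e⟫_ℝ ∧ ‖(walkRun X z k s).1 - s.1‖ ≤ 24 * ⟪(walkRun X z k s).1 - s.1, e⟫_ℝ :=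
  disp_le_of_cone_of_tilt_ref_wide hze (walkRun_spec hX hs₀ hcert hz k s hI).2.1

/-- **Reference heights never decrease along a run with a tilted vertical.** -/
theorem walkRun_refHeight_mono_wide (hX : ∀ p ∈ X, ∀ q ∈ X, p ≠ q → 1 ≤ dist p q)
    {s₀ : EuclideanSpace ℝ (Fin 3)} (hs₀ : s₀ ∈ fccSlots)
    (hcert : ExactOnly 0 (fccSlots.filter fun w => 0 < ⟪w, s₀⟫_ℝ))
    {z e : EuclideanSpace ℝ (Fin 3)} (hz : ‖z‖ = 1) (hze : ‖z - e‖ ≤ 1 / 3)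
    {s : EuclideanSpace ℝ (Fin 3) × List WalkEntry} (hI : WalkInv X z s) (k : ℕ) :
    ⟪(walkRun X z k s).1, e⟫_ℝ ≤ ⟪(walkRun X z (k + 1) s).1, e⟫_ℝ := by
  rw [walkRun_succ']
  have hIk := (walkRun_spec hX hs₀ hcert hz k s hI).1
  have h0 := (walkRun_disp_le_of_tilt_ref_wide hX hs₀ hcert hz hze hIk 1).1
  rw [inner_sub_left] at h0
  linarith

/-! ### One grain with a tilted vertical: deep prefix and non-revisiting, window by reference heights -/

section GrainTiltRefWide

variable (hX : ∀ p ∈ X, ∀ q ∈ X, p ≠ q → 1 ≤ dist p q)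
  {s₀ : EuclideanSpace ℝ (Fin 3)} (hs₀ : s₀ ∈ fccSlots)
  (hcert : ExactOnly 0 (fccSlots.filter fun w => 0 < ⟪w, s₀⟫_ℝ))
  {z : EuclideanSpace ℝ (Fin 3)} (hz : ‖z‖ = 1) (e : EuclideanSpace ℝ (Fin 3))
  (A : EuclideanSpace ℝ (Fin 3) ≃ₗᵢ[ℝ] EuclideanSpace ℝ (Fin 3)) (t₀ : EuclideanSpace ℝ (Fin 3))
  {u : EuclideanSpace ℝ (Fin 3)} (hu : u ∈ fccSlots) (hsteep : Real.sqrt 2 / 2 ≤ ⟪A u, z⟫_ℝ)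
  (S : Finset (EuclideanSpace ℝ (Fin 3))) {hlo Hd ρs ρ' : ℝ} (hρs : 0 ≤ ρs)
  (hS : ∀ p ∈ S, p ∈ X ∧ p ∈ (fun q => A q + t₀) '' fccStacking 1 (Real.sqrt (2 / 3)) ∧
    hlo ≤ ⟪p, e⟫_ℝ ∧ ⟪p, e⟫_ℝ ≤ Hd ∧ p 0 ^ 2 + p 1 ^ 2 ≤ ρs ^ 2)
  (hfullS : ∀ p ∈ S, ∀ w ∈ fccSlots, p + A w ∈ X)
  (hdeep : ∀ p ∈ X, p ∈ (fun q => A q + t₀) '' fccStacking 1 (Real.sqrt (2 / 3)) →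
    hlo ≤ ⟪p, e⟫_ℝ → ⟪p, e⟫_ℝ ≤ Hd → Real.sqrt (p 0 ^ 2 + p 1 ^ 2) ≤ ρ' → ∀ w ∈ fccSlots, p + A w ∈ X)
  (hroom : ρs + 3 * (Hd - hlo) ≤ ρ')
  (hconv : ∀ p ∈ S, ∀ i : ℕ, 1 ≤ i → p + ((i : ℕ) : ℝ) • A u ∈ S → p + A u ∈ S)

include hX hs₀ hcert hz hu hsteep hρs hS hfullS hdeep hroom in
/-- **The deep prefix (tilted vertical, reference-height window).**  A walker launched from `t′ ∈ S` that is still at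
reference height `≤ Hd` after `k` steps has made `k` FULL steps along `A u` and carries the bottom stack. -/
theorem walkRun_deep_prefix_tilt_ref_wide (hze : ‖z - e‖ ≤ 1 / 3) {t' : EuclideanSpace ℝ (Fin 3)} (ht' : t' ∈ S) (k : ℕ)
    (hk : ⟪(walkRun X z k (t' + A u, [⟨A, u, 0⟩])).1, e⟫_ℝ ≤ Hd) :
    walkRun X z k (t' + A u, [⟨A, u, 0⟩]) = (t' + A u + (k : ℝ) • A u, [⟨A, u, 0⟩]) := by
  induction k with
  | zero => simp
  | succ k IH =>
    obtain ⟨ht'X, ht'Λ, ht'lo, -, ht'r⟩ := hS t' ht'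
    have hI₀ : WalkInv X z (t' + A u, [⟨A, u, 0⟩]) := walkInv_start A ht'X (hfullS t' ht') hu hsteep
    have hmono := walkRun_refHeight_mono_wide hX hs₀ hcert hz hze hI₀ k
    have hk' : ⟪(walkRun X z k (t' + A u, [⟨A, u, 0⟩])).1, e⟫_ℝ ≤ Hd := hmono.trans hk
    have IH' := IH hk'
    set b : EuclideanSpace ℝ (Fin 3) := t' + A u + (k : ℝ) • A u with hb
    have hbX : b ∈ X := by
      have := (walkRun_spec hX hs₀ hcert hz k _ hI₀).1.1
      rw [IH'] at this; exact this
    -- `b` is a lattice ball in the sealed window: full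
    have hu3 : (11 / 30 : ℝ) ≤ ⟪A u, e⟫_ℝ := slot_ref_rise_of_tilt_wide hze A hu hsteep
    have hb2 : ⟪b, e⟫_ℝ = ⟪t', e⟫_ℝ + ((k : ℝ) + 1) * ⟪A u, e⟫_ℝ := by
      rw [hb, inner_add_left, inner_add_left, real_inner_smul_left]; ring
    have hblo : hlo ≤ ⟪b, e⟫_ℝ := by
      rw [hb2]; nlinarith
    have hbHd : ⟪b, e⟫_ℝ ≤ Hd := by rw [IH'] at hk'; exact hk'
    have hk1 : ((k : ℝ) + 1) * ⟪A u, e⟫_ℝ ≤ Hd - hlo := by linarith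
    have hk2 : (k : ℝ) + 1 ≤ 3 * (Hd - hlo) := by
      have h0 : 0 ≤ (k : ℝ) + 1 := by positivity
      nlinarith [hk1, hu3, h0]
    have hbΛ : b ∈ (fun q => A q + t₀) '' fccStacking 1 (Real.sqrt (2 / 3)) := by
      obtain ⟨q, hq, hqt⟩ := ht'Λ
      refine ⟨q + ((k + 1 : ℕ) : ℝ) • u, add_natCast_smul_mem_fcc hq (mem_fcc_of_mem_fccSlots hu) (k + 1), ?_⟩
      show A (q + ((k + 1 : ℕ) : ℝ) • u) + t₀ = b
      rw [hb, ← hqt, map_add, LinearIsometryEquiv.map_smul]; push_cast; module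
    have hblat : Real.sqrt (b 0 ^ 2 + b 1 ^ 2) ≤ ρ' := by
      have h1 := sqrt_lateral_add_le t' (A u + (k : ℝ) • A u)
      have e1 : t' + (A u + (k : ℝ) • A u) = b := by rw [hb]; abel
      rw [e1] at h1
      have h2 : ‖A u + (k : ℝ) • A u‖ = (k : ℝ) + 1 := by
        rw [show A u + (k : ℝ) • A u = ((k : ℝ) + 1) • A u by module, norm_smul, LinearIsometryEquiv.norm_map,
          norm_eq_one_of_mem_fccSlots hu, mul_one, Real.norm_eq_abs, abs_of_nonneg (by positivity)]
      have h3 : Real.sqrt (t' 0 ^ 2 + t' 1 ^ 2) ≤ ρs := by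
        rw [← Real.sqrt_sq hρs]; exact Real.sqrt_le_sqrt ht'r
      linarith
    have hfull : ∀ w ∈ fccSlots, b + A w ∈ X := hdeep b hbX hbΛ hblo hbHd hblat
    rw [walkRun_succ', IH', walkRun_succ_of_some X z 0 (walkStep_of_full X z b ⟨A, u, 0⟩ [] hfull), walkRun_zero]
    refine Prod.ext ?_ rfl
    show b + A u = t' + A u + ((k + 1 : ℕ) : ℝ) • A u
    rw [hb]; push_cast; module

include hX hs₀ hcert hz hu hsteep hρs hS hfullS hdeep hroom hconv in
/-- **A walker never visits another top's start state (tilted vertical, reference-height window).** -/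
theorem walkRun_ne_start_tilt_ref_wide (hze : ‖z - e‖ ≤ 1 / 3) {t t' : EuclideanSpace ℝ (Fin 3)} (ht : t ∈ S) (ht' : t' ∈ S)
    (htop' : t' + A u ∉ S) (i : ℕ) (h : walkRun X z i (t' + A u, [⟨A, u, 0⟩]) = (t + A u, [⟨A, u, 0⟩])) : t = t' := by
  induction i with
  | zero =>
    rw [walkRun_zero] at h
    injection h with h1
    exact (add_right_cancel h1).symm
  | succ i IH =>
    obtain ⟨ht'X, -, -, -, -⟩ := hS t' ht'
    obtain ⟨-, -, -, htHd, -⟩ := hS t ht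
    have hI₀ : WalkInv X z (t' + A u, [⟨A, u, 0⟩]) := walkInv_start A ht'X (hfullS t' ht') hu hsteep
    rw [walkRun_succ'] at h
    obtain ⟨hwI, hwW⟩ := walkRun_valid hX hs₀ hcert hz i hI₀ (stackWF_start z A u)
    rcases hws : walkRun X z i (t' + A u, [⟨A, u, 0⟩]) with ⟨yw, stk⟩
    rw [hws] at h hwI hwW
    cases hstep : walkStep X z (yw, stk) with
    | none =>
      rw [walkRun_succ_of_none X z 0 hstep] at h
      exact IH (hws.trans h)
    | some v =>
      rw [walkRun_succ_of_some X z 0 hstep, walkRun_zero] at h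
      subst h
      obtain ⟨-, hSw, ew, rw', hstk, -⟩ := hwI
      simp only at hstk hSw
      subst hstk
      exfalso
      rcases walkStep_cases hstep with ⟨hfullw, hs⟩ | ⟨n, hcap, ⟨e', rest', hr, hn, hs⟩ | ⟨-, hs⟩⟩
      · injection hs with hy hl
        injection hl with he hr
        subst he
        have hyt : t = yw := add_right_cancel hy
        subst hyt
        have hdeepi := walkRun_deep_prefix_tilt_ref_wide hX hs₀ hcert hz e A t₀ hu hsteep S hρs hS hfullS hdeep hroom hze
          ht' i (by rw [hws]; exact htHd)
        rw [hws] at hdeepi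
        injection hdeepi with hy' hl'
        have hmem : t' + (((i + 1 : ℕ)) : ℝ) • A u ∈ S := by
          have e : t' + (((i + 1 : ℕ)) : ℝ) • A u = t := by rw [hy']; push_cast; module
          rw [e]; exact ht
        exact htop' (hconv t' ht' (i + 1) (by omega) hmem)
      · subst hr
        injection hs with hy hl
        injection hl with he hr'
        subst he
        have hyt : t = yw := add_right_cancel hy
        subst hyt
        subst hn
        obtain ⟨hSo, hLi, -⟩ := hSw
        exact false_of_full_of_pop hX hSo hLi hcap (hfullS _ ht)
      · rw [pushMove_eq] at hs
        injection hs with _ hl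
        injection hl with _ hl'
        exact List.cons_ne_nil _ _ hl'.symm

include hX hs₀ hcert hz hu hsteep hρs hS hfullS hdeep hroom hconv in
/-- **`top ↦ end state` is injective (tilted vertical, reference-height window).** -/
theorem walkRun_start_injective_tilt_ref_wide (hze : ‖z - e‖ ≤ 1 / 3) {t t' : EuclideanSpace ℝ (Fin 3)} (ht : t ∈ S)
    (htop : t + A u ∉ S) (ht' : t' ∈ S) (htop' : t' + A u ∉ S) {N : ℕ}
    (h : walkRun X z N (t + A u, [⟨A, u, 0⟩]) = walkRun X z N (t' + A u, [⟨A, u, 0⟩])) : t = t' := by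
  have hI : WalkInv X z (t + A u, [⟨A, u, 0⟩]) := walkInv_start A (hS t ht).1 (hfullS t ht) hu hsteep
  have hI' : WalkInv X z (t' + A u, [⟨A, u, 0⟩]) := walkInv_start A (hS t' ht').1 (hfullS t' ht') hu hsteep
  rcases walkRun_eq_walkRun_orbit hX hs₀ hcert hz N hI (stackWF_start z A u) hI' (stackWF_start z A u) h with
    ⟨j, hj⟩ | ⟨j, hj⟩
  · exact (walkRun_ne_start_tilt_ref_wide hX hs₀ hcert hz e A t₀ hu hsteep S hρs hS hfullS hdeep hroom hconv hze ht' ht htop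
      j hj).symm
  · exact walkRun_ne_start_tilt_ref_wide hX hs₀ hcert hz e A t₀ hu hsteep S hρs hS hfullS hdeep hroom hconv hze ht ht' htop'
      j hj

end GrainTiltRefWide

end Summit.Ventures.Crystal3D.Theorems

end
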